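import Mathlib
import Literature.Analysis.FluidPDE.AxisymNoSwirlVorticity
import Summits.NavierStokesRegularity.NavierStokesRegularity.Theorems.EulerZoomLiouvillePowerGaugeEulerLiouvilleHoopSliceChart
import Summits.NavierStokesRegularity.NavierStokesRegularity.Theorems.EulerZoomLiouvillePowerGaugeEulerLiouvilleHoopSliceFrame

/-!
# R48 plate t51-FM: the FIRST-MODE TRANSPORT IDENTITY (nsreg-p2 ROUND-48 «EVERY LINE, EVERY BEND»,
`NsregP2.R48.FirstModeTransport`, text VERBATIM from `r48/Sketch48.lean` c9b3454dee49e2f5 l.115–121; seat ns-ezl-w2 g5,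
`--supports stmt-NavierStokesRegularity-19832 --as helper`)

For `C¹` `V` (no divergence constraint), a transverse vector `c` (`c₂ = 0`), every `s` and `T₀ > 0`:
`∫₀^{T₀} ⟨c_θ ω_z + c_r (div V − ∂_zV_z)⟩_θ (s, t) dt = ⟨⟪c, V⟫⟩_θ(s, T₀) − ⟪c, V(s e_z)⟫`.
Proof (smooth slice chart of ns-sfl-p1 g8, `…HoopSliceChart`): pointwise on the circle of radius `t > 0`,
`c_θ ω_z + c_r div_⊥V_⊥ = ∂_t ⟪c, V∘axisPt⟫ + t⁻¹ ∂_θ ⟪V∘axisPt, Jc⟫` with `Jc = c₀ e₁ − c₁ e₀` (`firstMode_pointwise`, a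
coordinate identity for the `2 × 2` block of `DV`); the `θ`-integral kills the second term (periodicity), the first is
`d/dt ∫_θ ⟪c, V∘axisPt⟫` (differentiation under the integral), and the `t`-integral over `[0, T₀]` is the fundamental theorem of
calculus, with `axisPt s 0 θ = s e_z`.

HONEST FRAMING: class-free calculus (a statement of a ROUND-48 instrument); nothing about the crux E (19832 OPEN) or NS
regularity. [nsreg-p2 R48 §1.3; folklore]
-/

noncomputable section

open Set Filter Topology Metric Function MeasureTheory Real WithLp
open scoped Interval InnerProductSpace RealInnerProductSpace

set_option linter.dupNamespace false

namespace Summit.NavierStokesRegularity.NavierStokesRegularity.Theorems.PowerGaugeEulerLiouville.HoopCore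

open Literature.Analysis Literature.Analysis.FluidPDE

/-- The pointwise coordinate identity behind the first-mode transport identity: for a linear `L` (`= DV(y)`), a transverse `c`
(`c₂ = 0`) and the rotated frame `R_θe₀, R_θe₁`:
`⟪c, R_θe₁⟫·(L₀₁ − L₁₀) + ⟪c, R_θe₀⟫·((L₀₀ + L₁₁ + L₂₂) − L₂₂) = ⟪c, L R_θe₀⟫ + ⟪L R_θe₁, c₀e₁ − c₁e₀⟫`
(`L_ij = (L eᵢ)_j`; i.e. `c_θ ω_z + c_r div_⊥ = ⟪c, ∂_r V⟫ + ⟪∂_θ̂ V, Jc⟫`). [folklore] -/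
theorem firstMode_pointwise (L : EuclideanSpace ℝ (Fin 3) →L[ℝ] EuclideanSpace ℝ (Fin 3)) (c : EuclideanSpace ℝ (Fin 3))
    (hc : c 2 = 0) (θ : ℝ) :
    ⟪c, rotZ θ (EuclideanSpace.single (1 : Fin 3) (1 : ℝ))⟫ *
        (L (EuclideanSpace.single 0 1) 1 - L (EuclideanSpace.single 1 1) 0) +
      ⟪c, rotZ θ (EuclideanSpace.single (0 : Fin 3) (1 : ℝ))⟫ *
        ((⟪EuclideanSpace.single (0 : Fin 3) (1 : ℝ), L (EuclideanSpace.single 0 1)⟫ +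
          ⟪EuclideanSpace.single (1 : Fin 3) (1 : ℝ), L (EuclideanSpace.single 1 1)⟫ +
          ⟪EuclideanSpace.single (2 : Fin 3) (1 : ℝ), L (EuclideanSpace.single 2 1)⟫) - L eZ 2) =
      ⟪c, L (rotZ θ (EuclideanSpace.single (0 : Fin 3) (1 : ℝ)))⟫ +
        ⟪L (rotZ θ (EuclideanSpace.single (1 : Fin 3) (1 : ℝ))),
          c 0 • EuclideanSpace.single (1 : Fin 3) (1 : ℝ) - c 1 • EuclideanSpace.single (0 : Fin 3) (1 : ℝ)⟫ := by
  simp only [rotZ_single_zero_eq, rotZ_single_one_eq, map_add, map_smul, map_neg, neg_smul,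
    inner_add_left, inner_sub_right, inner_smul_right, inner_smul_left, inner_neg_left,
    EuclideanSpace.inner_single_right, EuclideanSpace.inner_single_left, eZ, real_inner_eq_sum_three c]
  simp only [PiLp.add_apply, PiLp.smul_apply, PiLp.neg_apply, smul_eq_mul, conj_trivial, hc, PiLp.single_apply]
  norm_num
  ring

/-- **FIRST-MODE TRANSPORT IDENTITY** (`NsregP2.R48.FirstModeTransport`, text verbatim): for `C¹ V`, `c` with `c 2 = 0`,
`0 < T₀`: `∫₀^{T₀} circleAvg (c_θ·(curl V)₂ + c_r·(div V − (DV e_z)₂)) (s, t) dt = circleAvg ⟪c, V⟫ (s, T₀) − ⟪c, V(s•e_z)⟫`.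
[nsreg-p2 R48 §1.3; folklore] -/
theorem firstModeTransport :
    ∀ (V : EuclideanSpace ℝ (Fin 3) → EuclideanSpace ℝ (Fin 3)), ContDiff ℝ 1 V →
      ∀ (c : EuclideanSpace ℝ (Fin 3)), c 2 = 0 → ∀ (s T₀ : ℝ), 0 < T₀ →
        (∫ t in (0 : ℝ)..T₀,
            circleAvg (fun y => ⟪c, eTheta y⟫ * (curl V y) 2
              + ⟪c, eR y⟫ * (VectorCalculus.divergence V y - (fderiv ℝ V y eZ) 2)) s t)
          = circleAvg (fun y => ⟪c, V y⟫) s T₀ - ⟪c, V (s • eZ)⟫ := by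
  intro V hV c hc2 s T₀ hT₀
  have hVd : Differentiable ℝ V := hV.differentiable one_ne_zero
  have hVc : Continuous V := hV.continuous
  have hπ : (π : ℝ) ≠ 0 := Real.pi_ne_zero
  -- ### derivative laws along the chart
  have hGt : ∀ t θ, HasDerivAt (fun t => ⟪c, V (axisPt s t θ)⟫)
      ⟪c, fderiv ℝ V (axisPt s t θ) (rotZ θ (EuclideanSpace.single (0 : Fin 3) (1 : ℝ)))⟫ t := by
    intro t θ
    have h1 : HasDerivAt (fun t => V (axisPt s t θ))
        (fderiv ℝ V (axisPt s t θ) (rotZ θ (EuclideanSpace.single (0 : Fin 3) (1 : ℝ)))) t :=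
      (hVd _).hasFDerivAt.comp_hasDerivAt t (hasDerivAt_axisPt_radius' s t θ)
    have h := (hasDerivAt_const t c).inner ℝ h1
    simpa only [inner_zero_left, add_zero] using h
  have hHθ : ∀ t θ, HasDerivAt (fun θ => ⟪V (axisPt s t θ),
      c 0 • EuclideanSpace.single (1 : Fin 3) (1 : ℝ) - c 1 • EuclideanSpace.single (0 : Fin 3) (1 : ℝ)⟫)
      (t * ⟪fderiv ℝ V (axisPt s t θ) (rotZ θ (EuclideanSpace.single (1 : Fin 3) (1 : ℝ))),
        c 0 • EuclideanSpace.single (1 : Fin 3) (1 : ℝ) - c 1 • EuclideanSpace.single (0 : Fin 3) (1 : ℝ)⟫) θ := by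
    intro t θ
    have h1 : HasDerivAt (fun θ => V (axisPt s t θ))
        (fderiv ℝ V (axisPt s t θ) (t • rotZ θ (EuclideanSpace.single (1 : Fin 3) (1 : ℝ)))) θ :=
      (hVd _).hasFDerivAt.comp_hasDerivAt θ (hasDerivAt_axisPt_angle' s t θ)
    have h := h1.inner ℝ (hasDerivAt_const θ
      (c 0 • EuclideanSpace.single (1 : Fin 3) (1 : ℝ) - c 1 • EuclideanSpace.single (0 : Fin 3) (1 : ℝ)))
    refine h.congr_deriv ?_
    rw [inner_zero_right, zero_add, map_smul, real_inner_smul_left]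
  -- ### joint continuity
  have hGc : Continuous fun p : ℝ × ℝ × ℝ => ⟪c, V (axisPt p.1 p.2.1 p.2.2)⟫ :=
    continuous_const.inner (hVc.comp continuous_axisPt)
  have hG'c : Continuous fun p : ℝ × ℝ × ℝ =>
      ⟪c, fderiv ℝ V (axisPt p.1 p.2.1 p.2.2) (rotZ p.2.2 (EuclideanSpace.single (0 : Fin 3) (1 : ℝ)))⟫ :=
    continuous_const.inner ((((hV.continuous_fderiv one_ne_zero).comp continuous_axisPt).clm_apply
      (continuous_rotZ_single_zero.comp (continuous_snd.comp continuous_snd))))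
  have hH'c : Continuous fun p : ℝ × ℝ × ℝ =>
      ⟪fderiv ℝ V (axisPt p.1 p.2.1 p.2.2) (rotZ p.2.2 (EuclideanSpace.single (1 : Fin 3) (1 : ℝ))),
        c 0 • EuclideanSpace.single (1 : Fin 3) (1 : ℝ) - c 1 • EuclideanSpace.single (0 : Fin 3) (1 : ℝ)⟫ :=
    continuous_sliceEntry hV (w := fun _ => c 0 • EuclideanSpace.single (1 : Fin 3) (1 : ℝ) -
      c 1 • EuclideanSpace.single (0 : Fin 3) (1 : ℝ)) continuous_rotZ_single_one continuous_const
  have sec1 : ∀ {F : ℝ × ℝ × ℝ → ℝ}, Continuous F → ∀ σ t, Continuous fun θ : ℝ => F (σ, t, θ) :=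
    fun hF σ t => hF.comp (continuous_const.prodMk (continuous_const.prodMk continuous_id))
  -- ### `g(t) = ∫_θ ⟪c, V∘axisPt⟫` has derivative `∫_θ ⟪c, DV R_θe₀⟫` (every `t`)
  have hg : ∀ t, HasDerivAt (fun t => ∫ θ in (0 : ℝ)..2 * π, ⟪c, V (axisPt s t θ)⟫)
      (∫ θ in (0 : ℝ)..2 * π, ⟪c, fderiv ℝ V (axisPt s t θ) (rotZ θ (EuclideanSpace.single (0 : Fin 3) (1 : ℝ)))⟫) t :=
    fun t => hasDerivAt_intervalIntegral_of_continuous (F := fun t θ => ⟪c, V (axisPt s t θ)⟫)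
      (F' := fun t θ => ⟪c, fderiv ℝ V (axisPt s t θ) (rotZ θ (EuclideanSpace.single (0 : Fin 3) (1 : ℝ)))⟫)
      (fun t θ => hGt t θ) (continuous_uncurry_slice hGc s) (continuous_uncurry_slice hG'c s) 0 (2 * π) t
  have hg'c : Continuous fun t => ∫ θ in (0 : ℝ)..2 * π,
      ⟪c, fderiv ℝ V (axisPt s t θ) (rotZ θ (EuclideanSpace.single (0 : Fin 3) (1 : ℝ)))⟫ :=
    intervalIntegral.continuous_parametric_intervalIntegral_of_continuous' (continuous_uncurry_slice hG'c s) _ _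
  -- ### on each circle of radius `t > 0`: the transport integrand integrates to `∫_θ ⟪c, DV R_θe₀⟫`
  have hslice : ∀ t, 0 < t → ∫ θ in (0 : ℝ)..2 * π,
      (⟪c, eTheta (axisPt s t θ)⟫ * (curl V (axisPt s t θ)) 2 +
        ⟪c, eR (axisPt s t θ)⟫ * (VectorCalculus.divergence V (axisPt s t θ) - (fderiv ℝ V (axisPt s t θ) eZ) 2)) =
      ∫ θ in (0 : ℝ)..2 * π, ⟪c, fderiv ℝ V (axisPt s t θ) (rotZ θ (EuclideanSpace.single (0 : Fin 3) (1 : ℝ)))⟫ := by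
    intro t ht
    have hpt : ∀ θ, ⟪c, eTheta (axisPt s t θ)⟫ * (curl V (axisPt s t θ)) 2 +
        ⟪c, eR (axisPt s t θ)⟫ * (VectorCalculus.divergence V (axisPt s t θ) - (fderiv ℝ V (axisPt s t θ) eZ) 2) =
        ⟪c, fderiv ℝ V (axisPt s t θ) (rotZ θ (EuclideanSpace.single (0 : Fin 3) (1 : ℝ)))⟫ +
          t⁻¹ * (t * ⟪fderiv ℝ V (axisPt s t θ) (rotZ θ (EuclideanSpace.single (1 : Fin 3) (1 : ℝ))),
            c 0 • EuclideanSpace.single (1 : Fin 3) (1 : ℝ) - c 1 • EuclideanSpace.single (0 : Fin 3) (1 : ℝ)⟫) := by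
      intro θ
      rw [eTheta_axisPt s ht θ, eR_axisPt s ht θ, curl_apply_two,
        divergence_eq_sum_inner_fderiv (EuclideanSpace.basisFun (Fin 3) ℝ), Fin.sum_univ_three]
      simp only [EuclideanSpace.basisFun_apply]
      rw [firstMode_pointwise _ c hc2 θ, ← mul_assoc, inv_mul_cancel₀ ht.ne', one_mul]
    have i1 : IntervalIntegrable (fun θ => ⟪c, fderiv ℝ V (axisPt s t θ)
        (rotZ θ (EuclideanSpace.single (0 : Fin 3) (1 : ℝ)))⟫) volume 0 (2 * π) :=
      (sec1 hG'c s t).intervalIntegrable _ _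
    have i2 : IntervalIntegrable (fun θ => t⁻¹ * (t * ⟪fderiv ℝ V (axisPt s t θ)
        (rotZ θ (EuclideanSpace.single (1 : Fin 3) (1 : ℝ))),
          c 0 • EuclideanSpace.single (1 : Fin 3) (1 : ℝ) - c 1 • EuclideanSpace.single (0 : Fin 3) (1 : ℝ)⟫))
        volume 0 (2 * π) :=
      (continuous_const.mul (continuous_const.mul (sec1 hH'c s t))).intervalIntegrable _ _
    have hper : ∫ θ in (0 : ℝ)..2 * π, t * ⟪fderiv ℝ V (axisPt s t θ)
        (rotZ θ (EuclideanSpace.single (1 : Fin 3) (1 : ℝ))),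
          c 0 • EuclideanSpace.single (1 : Fin 3) (1 : ℝ) - c 1 • EuclideanSpace.single (0 : Fin 3) (1 : ℝ)⟫ = 0 := by
      rw [intervalIntegral.integral_eq_sub_of_hasDerivAt (fun θ _ => hHθ t θ)
        ((continuous_const.mul (sec1 hH'c s t)).intervalIntegrable _ _), axisPt_two_pi, sub_self]
    rw [intervalIntegral.integral_congr fun θ _ => hpt θ, intervalIntegral.integral_add i1 i2,
      intervalIntegral.integral_const_mul t⁻¹, hper, mul_zero, add_zero]
  -- ### the `t`-integral: integrands agree on `(0, T₀]`, then the fundamental theorem of calculus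
  have hcongr : ∫ t in (0 : ℝ)..T₀, circleAvg (fun y => ⟪c, eTheta y⟫ * (curl V y) 2 +
      ⟪c, eR y⟫ * (VectorCalculus.divergence V y - (fderiv ℝ V y eZ) 2)) s t =
      ∫ t in (0 : ℝ)..T₀, 1 / (2 * π) * ∫ θ in (0 : ℝ)..2 * π,
        ⟪c, fderiv ℝ V (axisPt s t θ) (rotZ θ (EuclideanSpace.single (0 : Fin 3) (1 : ℝ)))⟫ := by
    refine intervalIntegral.integral_congr_ae (Eventually.of_forall fun t ht => ?_)
    rw [uIoc_of_le hT₀.le] at ht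
    simp only [circleAvg]
    rw [hslice t ht.1]
  rw [hcongr, intervalIntegral.integral_const_mul,
    intervalIntegral.integral_eq_sub_of_hasDerivAt (fun t _ => hg t) (hg'c.intervalIntegrable _ _)]
  simp only [circleAvg, axisPt_radius_zero, intervalIntegral.integral_const, sub_zero, smul_eq_mul]
  field_simp

end Summit.NavierStokesRegularity.NavierStokesRegularity.Theorems.PowerGaugeEulerLiouville.HoopCore

end
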